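import Mathlib
import HarnessLib
import Summits.Ventures.LatticeQCDFlow.Scaling.EntropyLagLawDoeblin

/-!
# The printed dissipation estimate is at most an eighth of the squared work range: `kl ≤ (ΔW)²/8`

HONEST FRAMING: exact (Metropolis-corrected) sampling algorithms for lattice gauge theory;
figures of merit are autocorrelation/cost numbers at stated couplings and volumes; no
continuum-physics claim.

Venture `LatticeQCDFlow` (cell pub-lqcd), topic `Exactness`; FANOUT row 13 (`eng-snf`, GEN-25).
NEW WORK of the cell — a three-line corollary of the BUILT
`Scaling/EntropyLagLawDoeblin.log_sum_mul_exp_le_hoeffding` (Hoeffding's lemma for finite laws,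
itself from Mathlib's `ProbabilityTheory.hasSubgaussianMGF_of_mem_Icc`) read on the EMPIRICAL
measure of one record; not a published result beyond Hoeffding's lemma (NAMED ONLY); no
definition.  Companion of GEN-25 `…MeanWorkTruncation` (`0 ≤ kl`, `= 0` iff ties) and
`…SampleDissipationSandwich`.

WHY (row 13).  `estimators.free_energy(W)` prints
`kl = mean_W − dF_J = log((1/n)Σ_i e^{−(W_i − W̄)})` — the empirical log-moment-generating
function of the centred works at `t = −1`.  If all works of the record lie within a range `ΔW`
(`|W_i − W_j| ≤ ΔW`), Hoeffding's lemma on the uniform law gives, exactly and for every record,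

  **`kl ≤ ΔW²/8`** (`kl_le_sq_range_div_eight`), and more generally
  `log((1/n)Σ_i e^{t(W_i − W̄)}) ≤ t²ΔW²/8` for every real `t` (`log_avg_exp_mul_sub_avg_le`).

A unit-test identity for the estimator module (a record whose printed `kl` exceeds
`(max W − min W)²/8` is arithmetically impossible) and the sample shadow of the Gaussian-work
heuristic `⟨W_d⟩ ≈ var(W)/2 ≤ ΔW²/8`.

NOT CLAIMED: anything about the population; anything numerical.
-/

namespace Summit.Ventures.LatticeQCDFlow.Exactness.GeneralNCMC

open Finset Summit.Ventures.LatticeQCDFlow.Scaling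

section Hoeffding

variable {ι : Type*} [Fintype ι] [Nonempty ι]

/-- **Hoeffding on the empirical measure**: `log((1/n)Σ_i e^{t(W_i − W̄)}) ≤ t²·ΔW²/8` whenever
`|W_i − W_j| ≤ ΔW` for all `i, j`. -/
theorem log_avg_exp_mul_sub_avg_le (W : ι → ℝ) {ΔW : ℝ} (hΔ : ∀ i j, |W i - W j| ≤ ΔW) (t : ℝ) :
    Real.log ((∑ i, Real.exp (t * (W i - (∑ j, W j) / Fintype.card ι))) / Fintype.card ι)
      ≤ t ^ 2 * ΔW ^ 2 / 8 := by
  have hn : (0 : ℝ) < Fintype.card ι := by exact_mod_cast Fintype.card_pos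
  have h := log_sum_mul_exp_le_hoeffding (π := fun _ : ι => (Fintype.card ι : ℝ)⁻¹)
    (fun _ => by positivity)
    (by rw [sum_const, card_univ, nsmul_eq_mul, mul_inv_cancel₀ hn.ne']) W hΔ t
  have havg : ∑ x, (Fintype.card ι : ℝ)⁻¹ * W x = (∑ j, W j) / Fintype.card ι := by
    rw [← mul_sum, inv_mul_eq_div]
  rw [havg, ← mul_sum, inv_mul_eq_div] at h
  exact h

/-- **`kl ≤ ΔW²/8` on every record**: the printed dissipation estimate
`kl = mean_W − dF_J = mean_W + log((1/n)Σ_i e^{−W_i})` is at most an eighth of the squared work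
range. -/
theorem kl_le_sq_range_div_eight (W : ι → ℝ) {ΔW : ℝ} (hΔ : ∀ i j, |W i - W j| ≤ ΔW) :
    (∑ i, W i) / Fintype.card ι - -Real.log ((∑ i, Real.exp (-W i)) / Fintype.card ι)
      ≤ ΔW ^ 2 / 8 := by
  have hn : (0 : ℝ) < Fintype.card ι := by exact_mod_cast Fintype.card_pos
  have h := log_avg_exp_mul_sub_avg_le W hΔ (-1)
  -- `e^{−(W_i − W̄)} = e^{W̄} e^{−W_i}`: the centring factors out of the average
  have hsum : ∑ i, Real.exp (-1 * (W i - (∑ j, W j) / Fintype.card ι))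
      = Real.exp ((∑ j, W j) / Fintype.card ι) * ∑ i, Real.exp (-W i) := by
    rw [mul_sum]
    exact sum_congr rfl fun i _ => by rw [← Real.exp_add]; ring_nf
  have hpos : 0 < (∑ i, Real.exp (-W i)) / Fintype.card ι :=
    div_pos (sum_pos (fun i _ => Real.exp_pos _) univ_nonempty) hn
  rw [hsum, mul_div_assoc, Real.log_mul (Real.exp_pos _).ne' hpos.ne', Real.log_exp] at h
  linarith

end Hoeffding

end Summit.Ventures.LatticeQCDFlow.Exactness.GeneralNCMC
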